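import Literature.NumberTheory.QuadraticForms.HilbertSymbolNonDyadic
import HarnessLib

/-!
# Fields with a bilinear nondegenerate Hilbert symbol: binary forms and Serre's lemma

Topic `NumberTheory/QuadraticForms`; namespace `Literature.NumberTheory.QuadraticForms`. Everything
here is proved; pure field algebra.

Serre, *A Course in Arithmetic*, Ch. III §1.2 Thm 2: over `k = ℚ_p` "the Hilbert symbol is a
nondegenerate bilinear form on the `𝔽₂`-vector space `k^*/k^{*2}`"; and Ch. IV §2 then derives the
isotropy criteria for quadratic forms over `ℚ_p` (Thm 6) from exactly these two properties (plus
the count of square classes). This file isolates the two properties as a hypothesis structure on a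
field `F` with `2 ≠ 0`,

* `IsRegularHilbertField F` — the Hilbert symbol `(a, b)_F` (`hilbertSymbol F`, `= 1` iff
  `a x² + b y² = 1` is soluble) is multiplicative in each variable on `F^*` and nondegenerate
  (for a non-square `b` some `(a, b)_F = -1`),

and proves, for such a field, the two lemmas of Ch. IV §2.2 on which Theorem 6 rests:

* `exists_binary_eq_iff` — **Corollary (ii) to Thm 6** for binary forms, directly from the
  definition of the symbol: for `a b t ≠ 0`, `a x² + b y² = t` is soluble iff
  `(t, -ab)_F = (a, b)_F` (since `⟨a, b⟩` represents `t` iff `⟨a/t, b/t⟩` represents `1` iff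
  `(a/t, b/t)_F = 1`, and `(a/t, b/t) = (a,b)(t,a)(t,b)(t,t) = (a,b)(t,-ab)` by bilinearity and
  `(t, t) = (t, -1)`);
* `exists_hilbertSymbol_eq_and_eq` — the **Lemma of Ch. IV §2.2, part (c)**: writing
  `H_a^ε = {x : (x, a) = ε}`, if `H_a^ε` and `H_{a'}^{ε'}` are nonempty and disjoint then `a a'`
  is a square and `ε = -ε'`; stated contrapositively (a common element exists as soon as `a a'`
  is not a square), with an elementary proof from bilinearity and nondegeneracy alone (the
  characters `(·, a)`, `(·, a')` would take the values `(1,1)`, `(ε,-ε')`, `(-ε,ε')`, `(-1,-1)`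
  and never `(ε, ε')`, forcing `ε = -ε'` and `(x, a a') = 1` for all `x`) — Serre's proof counts
  `k^*/k^{*2}` instead.

These feed the isotropy of quadratic forms of rank `4` (`d ≠ 1`) and `≥ 5` over such fields
(`IsotropicRankFive.lean`), hence over Mathlib's `ℚ_[p]` (`PadicHilbertSymbol.lean`, discharging
the named fact `padic_representsZero_of_five_le` of `HasseMinkowski.lean`, Ch. IV §2.2 Thm 6 (iv)).

Relation to `HilbertSymbolLocalRepresentation.lean` (nearest prior art in the tree). That file
proves exactly these statements for the completions `K_v = v.adicCompletion K` of a number field: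
`hilbertSymbol_mul_mul_eq` (= `hilbertSymbol_div_div` here), `exists_binary_eq_iff_hilbertSymbol`
(= `exists_binary_eq_iff`), `exists_hilbertSymbol_eq_and_eq` (= the Lemma (c) here), from the
bimultiplicativity `hilbertSymbol_adicCompletion_mul_left/right` (`HilbertSymbolBilinear.lean`) and
the nondegeneracy `exists_hilbertSymbol_eq_neg_one_left`; those `K_v`-theorems are the instance of
the present ones for the structure `⟨(neZero_two_adicCompletion K v).out,
hilbertSymbol_adicCompletion_mul_left K v, exists_hilbertSymbol_eq_neg_one_left K v⟩`. The present
file abstracts the two properties into the hypothesis structure `IsRegularHilbertField` because its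
consumer is Mathlib's `ℚ_[p]` (the language of `padic_representsZero_of_five_le`), not an adic
completion; the symbol of `ℚ_[p]` is obtained by transport in `PadicHilbertSymbol.lean`. The
eight-line step `key` in `exists_binary_eq_iff` (`⟨a, b⟩` represents `t` iff `⟨a/t, b/t⟩`
represents `1`) is that file's field-level `exists_binary_eq_iff_hilbertSymbol_mul`, re-proved
rather than imported because that file's import closure contains the local-class-field-theory files
(`HilbertSymbolBilinear` → `QuadraticNormIndex`, `LocalNormIndex`), which this purely algebraic
file deliberately does not depend on. Not here: the counting of `k^*/k^{*2}` (Serre's proof of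
the Lemma), the invariants `d`, `ε` of a general form, Thm 6 (i) and Thm 7.

## References

* J.-P. Serre, *A Course in Arithmetic*, GTM 7, Springer 1973, Ch. III §1.1 Prop. 2, §1.2 Thm 2
  (PDF pp. 19–20); Ch. IV §2.2, Lemma and Corollary to Thm 6 (PDF pp. 34–36). [Serre1973]
-/

namespace Literature.NumberTheory.QuadraticForms

variable {F : Type*} [Field F]

/-! ### The hypothesis structure -/

/-- A field `F` with `2 ≠ 0` whose Hilbert symbol `(a, b)_F` (`hilbertSymbol F a b`, `= 1` iff
`a x² + b y² = 1` is soluble in `F`) is **bilinear and nondegenerate** on `F^*/F^{*2}`: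
multiplicative in the first (hence, by symmetry, each) variable on non-zero elements, and for
every non-square `b ≠ 0` there is `a ≠ 0` with `(a, b)_F = -1`. These are the properties of the
Hilbert symbol of `ℚ_p` and of `ℝ` established in Serre, *A Course in Arithmetic*, Ch. III §1.2
Thm 2 ("The Hilbert symbol is a nondegenerate bilinear form on the `𝔽₂`-vector space
`k^*/k^{*2}`"), and the only ones used in Ch. IV §2.2 Thm 6 (i)–(iii) ("their proofs use only the
nondegeneracy of the Hilbert symbol", Ch. IV §2.4). A hypothesis structure, not a fact.
[cite: Serre1973, Ch. III §1.2 Thm 2] -/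
structure IsRegularHilbertField (F : Type*) [Field F] : Prop where
  /-- the characteristic is not `2` -/
  two_ne_zero : (2 : F) ≠ 0
  /-- bilinearity: `(a b, c) = (a, c) (b, c)` for `a b c ≠ 0` -/
  mul_left : ∀ a b c : F, a ≠ 0 → b ≠ 0 → c ≠ 0 →
    hilbertSymbol F (a * b) c = hilbertSymbol F a c * hilbertSymbol F b c
  /-- nondegeneracy: a non-square `b ≠ 0` pairs to `-1` with some `a ≠ 0` -/
  exists_eq_neg_one : ∀ b : F, b ≠ 0 → ¬ IsSquare b → ∃ a : F, a ≠ 0 ∧ hilbertSymbol F a b = -1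

/-! ### Symbol calculus -/

/-- `(a⁻¹, b) = (a, b)` over any field (`a⁻¹ = a · (a⁻¹)²`). [folklore] -/
theorem hilbertSymbol_inv_left {a : F} (ha : a ≠ 0) (b : F) :
    hilbertSymbol F a⁻¹ b = hilbertSymbol F a b := by
  rw [show a⁻¹ = a * a⁻¹ ^ 2 by field_simp, hilbertSymbol_mul_sq_left _ _ (inv_ne_zero ha)]

/-- `(a, b⁻¹) = (a, b)` over any field. [folklore] -/
theorem hilbertSymbol_inv_right (a : F) {b : F} (hb : b ≠ 0) :
    hilbertSymbol F a b⁻¹ = hilbertSymbol F a b := by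
  rw [hilbertSymbol_comm, hilbertSymbol_inv_left hb, hilbertSymbol_comm]

/-- The product of two `±1`-valued integers is `1` iff they are equal. [folklore] -/
theorem sign_mul_eq_one_iff {x y : ℤ} (hx : x = 1 ∨ x = -1) (hy : y = 1 ∨ y = -1) :
    x * y = 1 ↔ x = y := by
  rcases hx with rfl | rfl <;> rcases hy with rfl | rfl <;> norm_num

namespace IsRegularHilbertField

variable (hF : IsRegularHilbertField F)
include hF

/-- Bilinearity in the second variable: `(a, b c) = (a, b) (a, c)`. [cite: Serre1973, Ch. III §1.2 Thm 2] -/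
theorem mul_right {a b c : F} (ha : a ≠ 0) (hb : b ≠ 0) (hc : c ≠ 0) :
    hilbertSymbol F a (b * c) = hilbertSymbol F a b * hilbertSymbol F a c := by
  rw [hilbertSymbol_comm, hF.mul_left b c a hb hc ha, hilbertSymbol_comm b, hilbertSymbol_comm c]

/-- `(t, t) = (t, -1)` (Serre, Ch. III §1.1 Prop. 2 (iv)). [cite: Serre1973, Ch. III §1.1 Prop. 2] -/
theorem self_right {t : F} (ht : t ≠ 0) : hilbertSymbol F t t = hilbertSymbol F t (-1) := by
  haveI : NeZero (2 : F) := ⟨hF.two_ne_zero⟩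
  exact hilbertSymbol_self_right ht

/-- **The symbol of a scaled binary form**: for `a b t ≠ 0`,
`(a/t, b/t) = (a, b) · (t, -ab)` (bilinearity and `(t,t) = (t,-1)`; the computation behind
Cor. (ii) to Thm 6, Serre Ch. IV §2.2). [cite: Serre1973, Ch. IV §2.2 Cor. to Thm 6] -/
theorem hilbertSymbol_div_div {a b t : F} (ha : a ≠ 0) (hb : b ≠ 0) (ht : t ≠ 0) :
    hilbertSymbol F (a / t) (b / t) = hilbertSymbol F a b * hilbertSymbol F t (-(a * b)) := by
  haveI : NeZero (2 : F) := ⟨hF.two_ne_zero⟩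
  have hti : t⁻¹ ≠ 0 := inv_ne_zero ht
  rw [div_eq_mul_inv, div_eq_mul_inv, hF.mul_left a t⁻¹ _ ha hti (mul_ne_zero hb hti),
    hF.mul_right ha hb hti, hF.mul_right hti hb hti, hilbertSymbol_inv_right a ht,
    hilbertSymbol_inv_left ht, hilbertSymbol_inv_left ht, hilbertSymbol_inv_right t ht,
    hF.self_right ht,
    show -(a * b) = a * (b * -1) by ring, hF.mul_right ht ha (mul_ne_zero hb (by simp)),
    hF.mul_right ht hb (by simp), hilbertSymbol_comm t a]
  have h1 := hilbertSymbol_eq_one_or_eq_neg_one a b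
  have h2 := hilbertSymbol_eq_one_or_eq_neg_one a t
  have h3 := hilbertSymbol_eq_one_or_eq_neg_one t b
  have h4 := hilbertSymbol_eq_one_or_eq_neg_one t (-1 : F)
  rcases h1 with h1 | h1 <;> rcases h2 with h2 | h2 <;> rcases h3 with h3 | h3 <;>
    rcases h4 with h4 | h4 <;> simp [h1, h2, h3, h4]

/-! ### Binary forms: Corollary (ii) -/

/-- **Values of a binary form** (Serre, Ch. IV §2.2, Cor. to Thm 6, (ii): "`n = 2` and
`(a, -d) = ε`"). Over a field with bilinear Hilbert symbol, for `a b t ≠ 0` the form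
`a X² + b Y²` represents `t` iff `(t, -ab)_F = (a, b)_F`. Indeed `⟨a, b⟩` represents `t` iff
`⟨a/t, b/t⟩` represents `1`, i.e. iff `(a/t, b/t)_F = 1` by the very definition of the symbol,
and `(a/t, b/t) = (a,b)(t,-ab)` (`hilbertSymbol_div_div`). [cite: Serre1973, Ch. IV §2.2 Cor. to Thm 6 (ii)] -/
theorem exists_binary_eq_iff {a b t : F} (ha : a ≠ 0) (hb : b ≠ 0) (ht : t ≠ 0) :
    (∃ x y : F, a * x ^ 2 + b * y ^ 2 = t) ↔
      hilbertSymbol F t (-(a * b)) = hilbertSymbol F a b := by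
  have key : (∃ x y : F, a * x ^ 2 + b * y ^ 2 = t) ↔
      ∃ x y : F, a / t * x ^ 2 + b / t * y ^ 2 = 1 := by
    constructor
    · rintro ⟨x, y, h⟩
      exact ⟨x, y, by rw [div_mul_eq_mul_div, div_mul_eq_mul_div, ← add_div, h, div_self ht]⟩
    · rintro ⟨x, y, h⟩
      refine ⟨x, y, ?_⟩
      rw [div_mul_eq_mul_div, div_mul_eq_mul_div, ← add_div, div_eq_one_iff_eq ht] at h
      exact h
  rw [key, ← hilbertSymbol_eq_one_iff, hF.hilbertSymbol_div_div ha hb ht, mul_comm,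
    sign_mul_eq_one_iff (hilbertSymbol_eq_one_or_eq_neg_one _ _)
      (hilbertSymbol_eq_one_or_eq_neg_one _ _)]

/-! ### Serre's lemma (c): disjoint symbol conditions -/

/-- **Serre's Lemma, Ch. IV §2.2 (c)**, in contrapositive form. Let `a a' ≠ 0` and `ε ε' = ±1`,
and suppose `(x₁, a) = ε` and `(x₂, a') = ε'` have solutions (the sets `H_a^ε`, `H_{a'}^{ε'}` are
nonempty). If `a a'` is not a square, some `x ≠ 0` satisfies both `(x, a) = ε` and
`(x, a') = ε'` (Serre: "if `H_a^ε` and `H_{a'}^{ε'}` are nonempty and disjoint, then `a = a'`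
in `k^*/k^{*2}` and `ε = -ε'`"). Proof from bilinearity and nondegeneracy: were the two
conditions incompatible, the pair of characters `((·,a), (·,a'))` would take the values
`(1,1), (ε,-ε'), (-ε,ε'), (-1,-1)` but not `(ε,ε')`, whence `ε = -ε'` and `(x,a) = (x,a')` for
all `x`, i.e. `(x, a a') = 1` for all `x`, so `a a'` is a square. [cite: Serre1973, Ch. IV §2.2 Lemma (c)] -/
theorem exists_hilbertSymbol_eq_and_eq {a a' : F} (ha : a ≠ 0) (ha' : a' ≠ 0) {ε ε' : ℤ}
    (h₁ : ∃ x : F, x ≠ 0 ∧ hilbertSymbol F x a = ε) (h₂ : ∃ x : F, x ≠ 0 ∧ hilbertSymbol F x a' = ε')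
    (hsq : ¬ IsSquare (a * a')) :
    ∃ x : F, x ≠ 0 ∧ hilbertSymbol F x a = ε ∧ hilbertSymbol F x a' = ε' := by
  by_contra hdis
  push Not at hdis
  obtain ⟨x₁, hx₁0, hx₁⟩ := h₁
  obtain ⟨x₂, hx₂0, hx₂⟩ := h₂
  have hε : ε = 1 ∨ ε = -1 := hx₁ ▸ hilbertSymbol_eq_one_or_eq_neg_one x₁ a
  have hε' : ε' = 1 ∨ ε' = -1 := hx₂ ▸ hilbertSymbol_eq_one_or_eq_neg_one x₂ a'
  -- the values at `x₁`, `x₂` are `(ε, -ε')`, `(-ε, ε')`, hence `(-1, -1)` at `x₁ x₂`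
  have hx₁' : hilbertSymbol F x₁ a' = -ε' := by
    have hne := hdis x₁ hx₁0 hx₁
    rcases hilbertSymbol_eq_one_or_eq_neg_one x₁ a' with h | h <;> rcases hε' with h' | h' <;>
      simp only [h, h'] at hne ⊢ <;> omega
  have hx₂' : hilbertSymbol F x₂ a = -ε := by
    have hne : hilbertSymbol F x₂ a ≠ ε := fun h => hdis x₂ hx₂0 h hx₂
    rcases hilbertSymbol_eq_one_or_eq_neg_one x₂ a with h | h <;> rcases hε with h' | h' <;>
      simp only [h, h'] at hne ⊢ <;> omega
  have h12a : hilbertSymbol F (x₁ * x₂) a = -1 := by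
    rw [hF.mul_left _ _ _ hx₁0 hx₂0 ha, hx₁, hx₂']
    rcases hε with rfl | rfl <;> norm_num
  have h12a' : hilbertSymbol F (x₁ * x₂) a' = -1 := by
    rw [hF.mul_left _ _ _ hx₁0 hx₂0 ha', hx₁', hx₂]
    rcases hε' with rfl | rfl <;> norm_num
  -- so `ε = -ε'` and `(x, a) = (x, a')` for every `x ≠ 0` (test `1`, `x₁x₂`, `x`, `x·x₁x₂`)
  have key : ∀ x : F, x ≠ 0 → hilbertSymbol F x a = hilbertSymbol F x a' ∧ ε = -ε' := by
    intro x hx0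
    have hx12 : x₁ * x₂ ≠ 0 := mul_ne_zero hx₁0 hx₂0
    have e0 : ¬ (ε = 1 ∧ ε' = 1) := fun hh =>
      hdis 1 one_ne_zero (by rw [hilbertSymbol_one_left, hh.1])
        (by rw [hilbertSymbol_one_left, hh.2])
    have e3 : ¬ (ε = -1 ∧ ε' = -1) := fun hh =>
      hdis (x₁ * x₂) hx12 (by rw [h12a, hh.1]) (by rw [h12a', hh.2])
    have e1 : ¬ (hilbertSymbol F x a = ε ∧ hilbertSymbol F x a' = ε') := fun hh =>
      hdis x hx0 hh.1 hh.2
    have e2 : ¬ (-hilbertSymbol F x a = ε ∧ -hilbertSymbol F x a' = ε') := fun hh =>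
      hdis (x * (x₁ * x₂)) (mul_ne_zero hx0 hx12)
        (by rw [hF.mul_left _ _ _ hx0 hx12 ha, h12a, mul_neg_one, hh.1])
        (by rw [hF.mul_left _ _ _ hx0 hx12 ha', h12a', mul_neg_one, hh.2])
    rcases hilbertSymbol_eq_one_or_eq_neg_one x a with h | h <;>
      rcases hilbertSymbol_eq_one_or_eq_neg_one x a' with h' | h' <;>
      rw [h, h'] at e1 e2 ⊢ <;> omega
  -- and `(x, a a') = 1` for all `x ≠ 0`: `a a'` is a square by nondegeneracy
  apply hsq
  by_contra hns
  obtain ⟨x, hx0, hx⟩ := hF.exists_eq_neg_one (a * a') (mul_ne_zero ha ha') hns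
  rw [hF.mul_right hx0 ha ha', (key x hx0).1, ← sq] at hx
  have h1 : (0 : ℤ) ≤ hilbertSymbol F x a' ^ 2 := sq_nonneg _
  omega

end IsRegularHilbertField

end Literature.NumberTheory.QuadraticForms
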